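import Summits.AtomisticToContinuum.Crystallization.Theorems.PalmUnimodularRigidityLayeredLawsSelectHcpRelaxedReferenceExclusion
import Summits.AtomisticToContinuum.Crystallization.Theorems.PalmUnimodularRigidityLayeredLawsSelectHcpZeroStress
import Summits.AtomisticToContinuum.Crystallization.Theorems.ExcessDecayLiouvilleCoarseGrainsPinNumerics

/-!
# The relaxed hcp reference exists and sits in the window
(stub `stub_relaxedReference` of line `mtp-prestress-split-ergodic-frame`, crux `LayeredLawsSelectHcp`,
stmt-AtomisticToContinuum-9226)

The total hcp energy function `hcpE a h = ½ ∑_{v ≠ 0} V_LJ(√(a² Q v + k² h²))` (the Defs module) attains its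
global minimum over the open quadrant `{a > 0, h > 0}` at a point of the window
`[0.945, 0.995] × [0.77, 0.815]`.  Proof.

* SHAPE REDUCTION (landed series algebra `hcpE_latticeSums`, `hcpPinC_dilation_value`): with `h = a c` and the
  pure lattice sums `S₃(c) = hcpSumS 3 c`, `S₆(c) = hcpSumS 6 c` of `…CoarseGrainsPinSums` (the same series:
  `hcpSumQ = hcpQ` by `rfl`), `hcpE a (a c) = ½ (a⁻¹² S₆/12 − a⁻⁶ S₃/6) ≥ −F(c)/24`, `F = S₃²/S₆`, with
  equality at `a⁶ = S₆/S₃`.  So a global maximiser `c₀` of the shape function `F` on `(0, ∞)` gives the global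
  minimiser `a₀ = (S₆/S₃)(c₀)^{1/6}`, `h₀ = a₀ c₀`.
* THE MAXIMISER: `S₃`, `S₆` are differentiable (`hcpPinC_hasDerivAt_tsum`), so `F` is continuous on
  `(0, ∞)` and has a maximiser `c₀` on the compact box `[0.78, 0.85]` (`IsCompact.exists_isMaxOn`); outside
  the box `F ≤ 14.457431022²/12.138038647 ≤ F(0.8164) ≤ F(c₀)` by the certified exclusion of part E
  (`stub_relaxedReferenceExclusion`) and the certified grid point `hcpSum_grid_8164`.  Hence `c₀` is a GLOBAL
  maximiser, and shape maximality on the box feeds the landed pin numerics `hcpSum_main`: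
  `a₀⁶ = S₆/S₃ ∈ [0.945⁶, 0.995⁶]`, `(27/8) c₀⁶ a₀⁶ ∈ [0.945⁶, 0.995⁶]`, whence `a₀ ∈ [0.945, 0.995]` and
  `h₀⁶ = c₀⁶ a₀⁶ ∈ [(8/27) 0.945⁶, (8/27) 0.995⁶] ⊂ [0.77⁶, 0.815⁶]`.

All `[folklore]`.
-/

noncomputable section

namespace Summit.AtomisticToContinuum.Crystallization.Theorems.PalmUnimodularRigidity.LayeredLawsSelectHcp

open MeasureTheory Set
open Literature.MathematicalPhysics.StatisticalMechanics Literature.Geometry.DiscreteGeometry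
open Summit.AtomisticToContinuum.Crystallization.Theorems.ExcessDecayLiouvilleCoarseGrains

/-- Euclidean `3`-space. [folklore] -/
local notation "E3" => EuclideanSpace ℝ (Fin 3)

/-! ## The line's lattice sums are the certified ones -/

/-- The form `Q` of the certified lattice sums (`…CoarseGrainsPinSums`) is the line's `hcpQ`. [folklore] -/
theorem hcpSumQ_eq_hcpQ : hcpSumQ = hcpQ := rfl

/-- The certified lattice sum `hcpSumS n c` is the line's series `∑' [v ≠ 0] (Q v + k²c²)⁻ⁿ`. [folklore] -/
theorem hcpSumS_eq_tsum (n : ℕ) (c : ℝ) : hcpSumS n c =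
    ∑' v : ℤ × ℤ × ℤ, if v = 0 then (0 : ℝ) else ((hcpQ v + (v.1 : ℝ) ^ 2 * c ^ 2)⁻¹) ^ n := rfl

/-- **The energy at `(a, a c)` through the certified sums**:
`hcpE a (a c) = ½ (a⁻¹² S₆(c)/12 − a⁻⁶ S₃(c)/6)` (`a, c ≠ 0`). [folklore] -/
theorem hcpE_eq_hcpSumS {a c : ℝ} (ha : a ≠ 0) (hc : c ≠ 0) :
    hcpE a (a * c) = 1 / 2 * ((1 / 12) * (a ^ 12)⁻¹ * hcpSumS 6 c - (1 / 6) * (a ^ 6)⁻¹ * hcpSumS 3 c) :=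
  (hcpE_latticeSums ha hc).2.2

/-- The certified sums are positive for every `c > 0`. [folklore] -/
theorem hcpSumS_pos' {n : ℕ} (hn : 3 ≤ n) {c : ℝ} (hc : 0 < c) : 0 < hcpSumS n c :=
  zero_lt_one.trans_le (hcpSum_one_le_hcpSumS_gen hn hc)

/-- **Lower bound by the optimal dilation**: `hcpE a (a c) ≥ −S₃(c)²/(24 S₆(c))` for all `a, c > 0`
(the parabola in `a⁻⁶`). [folklore] -/
theorem hcpE_ge_shape {a c : ℝ} (ha : 0 < a) (hc : 0 < c) :
    -(hcpSumS 3 c ^ 2 / (24 * hcpSumS 6 c)) ≤ hcpE a (a * c) := by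
  rw [hcpE_eq_hcpSumS ha.ne' hc.ne']
  have h6 := hcpSumS_pos' (by norm_num : 3 ≤ 6) hc
  have ha' : a ≠ 0 := ha.ne'
  have key : 1 / 2 * ((1 / 12) * (a ^ 12)⁻¹ * hcpSumS 6 c - (1 / 6) * (a ^ 6)⁻¹ * hcpSumS 3 c) +
      hcpSumS 3 c ^ 2 / (24 * hcpSumS 6 c) =
        (hcpSumS 6 c - hcpSumS 3 c * a ^ 6) ^ 2 / (24 * hcpSumS 6 c * a ^ 12) := by
    field_simp
    ring
  have hnn : 0 ≤ (hcpSumS 6 c - hcpSumS 3 c * a ^ 6) ^ 2 / (24 * hcpSumS 6 c * a ^ 12) := by positivity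
  linarith

/-! ## Continuity of the shape function -/

/-- The certified sums are continuous on `(0, ∞)` (they are differentiable: `hcpPinC_hasDerivAt_tsum`).
[folklore] -/
theorem continuousAt_hcpSumS {n : ℕ} (hn : 3 ≤ n) {c : ℝ} (hc : 0 < c) : ContinuousAt (hcpSumS n) c :=
  (hcpPinC_hasDerivAt_tsum (Q := hcpSumQ) hcpSumQ_nonneg (fun v hv hk => hcpPinC_Q_pos v hv hk) n hc
    (hcpSumTerm_summable_gen hn (half_pos hc)) (hcpSumTerm_summable_gen hn hc)).continuousAt

/-- The shape function `F = S₃²/S₆` is continuous on `(0, ∞)`. [folklore] -/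
theorem continuousOn_shape :
    ContinuousOn (fun c : ℝ => hcpSumS 3 c ^ 2 / hcpSumS 6 c) (Set.Ioi 0) := by
  intro c hc
  have hc' : (0 : ℝ) < c := hc
  exact (((continuousAt_hcpSumS le_rfl hc').pow 2).div (continuousAt_hcpSumS (by norm_num) hc')
    (hcpSumS_pos' (by norm_num) hc').ne').continuousWithinAt

/-! ## The statement -/

/-- **Stub `stub_relaxedReference` of line `mtp-prestress-split-ergodic-frame` (crux `LayeredLawsSelectHcp`,
stmt-AtomisticToContinuum-9226): THE RELAXED hcp REFERENCE EXISTS AND SITS IN THE WINDOW.**  The total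
energy function `hcpE` has a global minimiser `(a₀, h₀)` over the open quadrant with
`a₀ ∈ [0.945, 0.995]`, `h₀ ∈ [0.77, 0.815]`: the maximiser `c₀ ∈ [0.78, 0.85]` of the shape function
`S₃²/S₆` (compactness + the certified exclusion outside the box), `a₀⁶ = S₆(c₀)/S₃(c₀)`, `h₀ = a₀ c₀`, and
the landed pin numerics `hcpSum_main`. [folklore] -/
theorem stub_relaxedReference : ∃ a₀ h₀ : ℝ, 189 / 200 ≤ a₀ ∧ a₀ ≤ 199 / 200 ∧ 77 / 100 ≤ h₀ ∧ h₀ ≤ 163 / 200 ∧ ∀ a h : ℝ, 0 < a → 0 < h → hcpE a₀ h₀ ≤ hcpE a h := by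
  -- the shape function and a maximiser on the box
  set F : ℝ → ℝ := fun c => hcpSumS 3 c ^ 2 / hcpSumS 6 c with hF
  have hcont : ContinuousOn F (Set.Icc (39 / 50) (17 / 20)) :=
    continuousOn_shape.mono fun c hc => lt_of_lt_of_le (by norm_num) hc.1
  obtain ⟨c₀, hc₀, hmax⟩ :=
    (isCompact_Icc : IsCompact (Set.Icc (39 / 50 : ℝ) (17 / 20))).exists_isMaxOn
      (Set.nonempty_Icc.2 (by norm_num)) hcont
  have hc₀pos : 0 < c₀ := lt_of_lt_of_le (by norm_num) hc₀.1
  have hbox : ∀ c', 39 / 50 ≤ c' → c' ≤ 17 / 20 → F c' ≤ F c₀ := fun c' h1 h2 => hmax ⟨h1, h2⟩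
  -- global maximality of the shape function at `c₀`
  have hFle : ∀ c, 0 < c → F c ≤ F c₀ := by
    intro c hc
    by_cases hin : 39 / 50 ≤ c ∧ c ≤ 17 / 20
    · exact hbox c hin.1 hin.2
    · have hout : c ≤ 39 / 50 ∨ 17 / 20 ≤ c := by
        rcases not_and_or.1 hin with h | h
        · exact Or.inl (le_of_lt (not_le.1 h))
        · exact Or.inr (le_of_lt (not_le.1 h))
      have hex := stub_relaxedReferenceExclusion c hc hout
      have h6 := hcpSumS_pos' (by norm_num : 3 ≤ 6) hc
      have hFc : F c ≤ 14.457431022 ^ 2 / 12.138038647 := by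
        simp only [hF]
        rw [div_le_div_iff₀ h6 (by norm_num)]
        linarith
      obtain ⟨g1, -, -, g4⟩ := hcpSum_grid_8164
      have h6' := hcpSumS_pos' (by norm_num : 3 ≤ 6) (show (0 : ℝ) < (8164 : ℝ) / 10000 by norm_num)
      have hFc' : 14.457431022 ^ 2 / 12.138038647 ≤ F ((8164 : ℝ) / 10000) := by
        simp only [hF]
        rw [div_le_div_iff₀ (by norm_num) h6']
        have hsq : (14.457431022 : ℝ) ^ 2 ≤ hcpSumS 3 ((8164 : ℝ) / 10000) ^ 2 :=
          pow_le_pow_left₀ (by norm_num) g1 2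
        nlinarith
      exact hFc.trans (hFc'.trans (hbox _ (by norm_num) (by norm_num)))
  -- the pin numerics at `c₀`
  obtain ⟨hb1, hb2, hb3, hb4⟩ := hcpSum_main c₀ hc₀.1 hc₀.2 hbox
  have hS3 := hcpSumS_pos' (le_refl 3) hc₀pos
  have hS6 := hcpSumS_pos' (by norm_num : 3 ≤ 6) hc₀pos
  have hq : 0 < hcpSumS 6 c₀ / hcpSumS 3 c₀ := div_pos hS6 hS3
  obtain ⟨a₀, ha₀, ha6⟩ : ∃ b : ℝ, 0 < b ∧ b ^ 6 = hcpSumS 6 c₀ / hcpSumS 3 c₀ :=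
    ⟨(hcpSumS 6 c₀ / hcpSumS 3 c₀) ^ ((6 : ℕ) : ℝ)⁻¹, Real.rpow_pos_of_pos hq _,
      Real.rpow_inv_natCast_pow hq.le (by norm_num)⟩
  rw [← ha6] at hb1 hb2 hb3 hb4
  have h6ne : (6 : ℕ) ≠ 0 := by norm_num
  have hh₀ : 0 ≤ a₀ * c₀ := by positivity
  have hh6 : (a₀ * c₀) ^ 6 = c₀ ^ 6 * a₀ ^ 6 := by ring
  refine ⟨a₀, a₀ * c₀, ?_, ?_, ?_, ?_, ?_⟩
  · exact (pow_le_pow_iff_left₀ (by norm_num) ha₀.le h6ne).1 hb1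
  · exact (pow_le_pow_iff_left₀ ha₀.le (by norm_num) h6ne).1 hb2
  · refine (pow_le_pow_iff_left₀ (by norm_num) hh₀ h6ne).1 ?_
    rw [hh6]
    have hnum : ((77 : ℝ) / 100) ^ 6 ≤ 8 / 27 * (189 / 200 : ℝ) ^ 6 := by norm_num
    nlinarith
  · refine (pow_le_pow_iff_left₀ hh₀ (by norm_num) h6ne).1 ?_
    rw [hh6]
    have hnum : 8 / 27 * (199 / 200 : ℝ) ^ 6 ≤ ((163 : ℝ) / 200) ^ 6 := by norm_num
    nlinarith
  · intro a h ha hh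
    obtain ⟨c, rfl⟩ : ∃ c, h = a * c := ⟨h / a, by field_simp⟩
    have hc : 0 < c := pos_of_mul_pos_right hh ha.le
    rw [hcpE_eq_hcpSumS ha₀.ne' hc₀pos.ne', hcpPinC_dilation_value hS3 hS6 ha6]
    have hFc := hFle c hc
    simp only [hF] at hFc
    have e1 : hcpSumS 3 c ^ 2 / (24 * hcpSumS 6 c) = hcpSumS 3 c ^ 2 / hcpSumS 6 c / 24 := by
      rw [div_div, mul_comm]
    have e2 : hcpSumS 3 c₀ ^ 2 / (24 * hcpSumS 6 c₀) = hcpSumS 3 c₀ ^ 2 / hcpSumS 6 c₀ / 24 := by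
      rw [div_div, mul_comm]
    calc -(hcpSumS 3 c₀ ^ 2 / (24 * hcpSumS 6 c₀)) ≤ -(hcpSumS 3 c ^ 2 / (24 * hcpSumS 6 c)) := by
          rw [e1, e2]; linarith
      _ ≤ hcpE a (a * c) := hcpE_ge_shape ha hc

end Summit.AtomisticToContinuum.Crystallization.Theorems.PalmUnimodularRigidity.LayeredLawsSelectHcp

end
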